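import Summits.HodgeConjecture.CorCM.CyclotomicTwoPowerPQuarticNormDescent
import HarnessLib

/-!
# `ω^{2^{j−1}}` is not a norm of DEGREE `2^j` from `ℤ[ζ_{2^{a+1}p}]` to the fixed ring of `ζ ↦ ζ^e`
# (`e ≡ 1 (mod 2^{a+1})`, `e^{2^j} ≡ 1 (mod p)`): the residue-field descent with `2^j`-th powers

COR-CM (cell `pub-hodgecm2`), binder seat b04 (gen 27), count-neutral — the `2^j`-SHEET PROGRAMME (A7-JUNCTION gen-26
addendum §C, road map (iv)): the order-`n` form of `CorCM/CyclotomicTwoPowerPResidueDescent` (`n = 2`) and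
`CorCM/CyclotomicTwoPowerPQuarticNormDescent` (`n = 4`).  For `G = C_p ⋊_r C_{2^m}` with `r` of order dividing `2^j`
the annihilator blocks are left multiplications in the cyclic algebra `𝔄 = (L/L₀, σ, ω)` of degree `n = 2^j`,
`L = ℚ(ζ_{2^{a+1}p})` (`a + 1 = m − j`), `σ : ζ_p ↦ ζ_p^r` fixing `μ_{2^{a+1}}`; a singular block with a non-zero type
forces `ω^{2^{j−1}} ∈ N_{L/L₀}(L^×)` (`CorCM/SemilinearKernelNormCyclic`).  This file is the arithmetic half of the
refutation: in `Λ = ℤ[X]/(Φ_{2^{a+1}p})` with generator `μ`, `η = −μ^{2^a}`, `g = 1 + μ^{2^a} = 1 − η`, for ANY ring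
endomorphism `σ` of `Λ` with `σ(μ) = μ^e` (`e ≡ 1 (mod 2^{a+1})`, `e^n ≡ 1 (mod p)`) and ANY residue map `π : Λ → k`
(`k ⊇ 𝔽_p` a field, `π(μ) = s`, `s^{2^a} = −1`):

THEOREM (`descent_pow`).  If `1 ≤ j ≤ a + 1` and NO `x ∈ k` has `x^{2^{a+1}} = −1`, then no `Z ∈ Λ`, `N ≥ 1`, `t₀` odd and
`U ∈ Λ` with `π(U)` a non-zero `2^j`-th power satisfy `∏_{i<2^j} σ^i(Z) = N^{2^j} μ^{p 2^{j−1} t₀} U`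
(`μ^{p 2^{j−1} t₀} = ω^{2^{j−1}}` for the primitive `2^{a+1}`-th root of unity `ω = μ^{p t₀}`).
PROOF.  `π ∘ σ^i = π`, `π_R ∘ σ^i = π_R` (`e ≡ 1 (mod 2^{a+1})`).  If `p ∤ N`: `x = π(Z)/(N̄ c)` has `x^{2^j} = s^{p 2^{j−1} t₀}`,
so `x^{2^{a+1}} = (s^{2^a})^{p t₀} = −1` — excluded.  If `p ∣ N`: `π_R(Z)^{n} = 0`, `R = 𝔽_p[X]/(X^{2^a}+1)` reduced, so
`Z = g Z₁`; `σ^i(g) = g · u_i`, `u_i = 1 + η + ⋯ + η^{e^i − 1}`, with inverse `v_i = Σ_{t < e^{n−i}} η^{e^i t}`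
(`e^n ≡ 1 (mod p)`), and `p = g^{p−1} ε`: peel `p − 1` times `n` factors of `g` and recurse on `N/p` (`π(∏ v_i)` is a unit of
`𝔽_p`, whose `(p−1)`-st power is `1`; `π(ε) = (p−1)! ≠ 0`).  KERNEL ONLY: theorems; no definition, no named fact, no `sorry`.

* §1 iterates: `pow_apply_root`, `iterate_mul`, `iterate_pow'`, `liftR_iterate_eq`, `pi_iterate_eq`, `pow_two_pow_eq_zero_R`,
  `pow_eq_zero_R`.
* §2 units: `iterate_one_add_root_pow`, `prod_geom_mul_geom_eq_one`, `cast_exp_ne_zero`, `pi_prod_geom_pow_eq_one`.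
* §3 `peel_pow`, `peel_pow_iter`.   §4 **`descent_pow`**.

## References

* [FeinGordonSmith1971] B. Fein, B. Gordon, J. H. Smith, J. Number Theory 3 (1971), 310–315 (the `2`-adic prototype).
* [Washington1997] L. C. Washington, *Introduction to Cyclotomic Fields*, Prop. 2.8, Thm. 2.13.
* [Pierce1982] R. S. Pierce, *Associative Algebras*, GTM 88, Springer 1982, §15.1 (cyclic algebras; the norm criterion).
-/

noncomputable section

open Polynomial

namespace Summit.HodgeConjecture.CorCM.CyclotomicTwoPowerP.Cyclic

open Summit.HodgeConjecture.CorCM.CyclotomicTwoPowerP.Quartic (map_one_add_root_pow geom_mul_geom_eq_one liftR_comp_eq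
  pi_comp_eq pi_geom pi_eps_ne_zero)

variable {p a e : ℕ}

/-! ## §1 Iterates of `σ` and of the residue maps -/

section Iterates

/-- `σ^i(μ) = μ^{e^i}` for `σ(μ) = μ^e`. [folklore] -/
theorem pow_apply_root (σ : AdjoinRoot (cyclotomic (2 ^ (a + 1) * p) ℤ) →+* AdjoinRoot (cyclotomic (2 ^ (a + 1) * p) ℤ))
    (hσ : σ (AdjoinRoot.root (cyclotomic (2 ^ (a + 1) * p) ℤ)) = AdjoinRoot.root (cyclotomic (2 ^ (a + 1) * p) ℤ) ^ e)
    (i : ℕ) : (σ ^ i) (AdjoinRoot.root (cyclotomic (2 ^ (a + 1) * p) ℤ)) =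
      AdjoinRoot.root (cyclotomic (2 ^ (a + 1) * p) ℤ) ^ (e ^ i) := by
  induction i with
  | zero => simp
  | succ i ih => rw [pow_succ σ i, RingHom.coe_mul, Function.comp_apply, hσ, map_pow, ih, ← pow_mul, ← pow_succ]

/-- `σ^i(x y) = σ^i(x) σ^i(y)` (iterate form). [folklore] -/
theorem iterate_mul (σ : AdjoinRoot (cyclotomic (2 ^ (a + 1) * p) ℤ) →+* AdjoinRoot (cyclotomic (2 ^ (a + 1) * p) ℤ))
    (i : ℕ) (x y : AdjoinRoot (cyclotomic (2 ^ (a + 1) * p) ℤ)) : σ^[i] (x * y) = σ^[i] x * σ^[i] y := by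
  rw [← RingHom.coe_pow, map_mul]

/-- `σ^i(x^m) = σ^i(x)^m` (iterate form). [folklore] -/
theorem iterate_pow' (σ : AdjoinRoot (cyclotomic (2 ^ (a + 1) * p) ℤ) →+* AdjoinRoot (cyclotomic (2 ^ (a + 1) * p) ℤ))
    (i m : ℕ) (x : AdjoinRoot (cyclotomic (2 ^ (a + 1) * p) ℤ)) : σ^[i] (x ^ m) = (σ^[i] x) ^ m := by
  rw [← RingHom.coe_pow, map_pow]

/-- **`π_R ∘ σ^i = π_R`** on `R = 𝔽_p[X]/(X^{2^a}+1)` (`e ≡ 1 (mod 2^{a+1})`). [folklore] -/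
theorem liftR_iterate_eq (hp : p.Prime) (hp2 : p ≠ 2) (he : e % 2 ^ (a + 1) = 1)
    (σ : AdjoinRoot (cyclotomic (2 ^ (a + 1) * p) ℤ) →+* AdjoinRoot (cyclotomic (2 ^ (a + 1) * p) ℤ))
    (hσ : σ (AdjoinRoot.root (cyclotomic (2 ^ (a + 1) * p) ℤ)) = AdjoinRoot.root (cyclotomic (2 ^ (a + 1) * p) ℤ) ^ e)
    (i : ℕ) (Z : AdjoinRoot (cyclotomic (2 ^ (a + 1) * p) ℤ)) :
    AdjoinRoot.lift (Int.castRingHom _) (AdjoinRoot.root (X ^ 2 ^ a + 1 : (ZMod p)[X])) (eval₂_cyclotomic_R hp hp2) (σ^[i] Z) =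
      AdjoinRoot.lift (Int.castRingHom _) (AdjoinRoot.root (X ^ 2 ^ a + 1 : (ZMod p)[X])) (eval₂_cyclotomic_R hp hp2) Z := by
  induction i with
  | zero => rfl
  | succ i ih => rw [Function.iterate_succ_apply', liftR_comp_eq hp hp2 he σ hσ, ih]

/-- **`π ∘ σ^i = π`** for every residue map `π : Λ → k` with `π(μ) = s`, `s^{2^a} = −1`. [folklore] -/
theorem pi_iterate_eq {k : Type*} [Field k] (he : e % 2 ^ (a + 1) = 1)
    (σ : AdjoinRoot (cyclotomic (2 ^ (a + 1) * p) ℤ) →+* AdjoinRoot (cyclotomic (2 ^ (a + 1) * p) ℤ))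
    (hσ : σ (AdjoinRoot.root (cyclotomic (2 ^ (a + 1) * p) ℤ)) = AdjoinRoot.root (cyclotomic (2 ^ (a + 1) * p) ℤ) ^ e)
    (π : AdjoinRoot (cyclotomic (2 ^ (a + 1) * p) ℤ) →+* k) {s : k}
    (hπ : π (AdjoinRoot.root (cyclotomic (2 ^ (a + 1) * p) ℤ)) = s) (hs : s ^ 2 ^ a = -1)
    (i : ℕ) (Z : AdjoinRoot (cyclotomic (2 ^ (a + 1) * p) ℤ)) : π (σ^[i] Z) = π Z := by
  induction i with
  | zero => rfl
  | succ i ih => rw [Function.iterate_succ_apply', pi_comp_eq he σ hσ π hπ hs, ih]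

/-- `R = 𝔽_p[X]/(X^{2^a}+1)` is reduced: `x^{2^j} = 0 ⟹ x = 0`. [folklore] -/
theorem pow_two_pow_eq_zero_R (hp : p.Prime) (hp2 : p ≠ 2) :
    ∀ (j : ℕ) (x : AdjoinRoot (X ^ 2 ^ a + 1 : (ZMod p)[X])), x ^ 2 ^ j = 0 → x = 0 := by
  intro j
  induction j with
  | zero => intro x hx; rwa [pow_zero, pow_one] at hx
  | succ j ih =>
    intro x hx
    refine ih x (eq_zero_of_sq_eq_zero_R hp hp2 _ ?_)
    rw [← pow_mul, ← pow_succ, hx]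

/-- `R` is reduced: `x^n = 0 ⟹ x = 0`. [folklore] -/
theorem pow_eq_zero_R (hp : p.Prime) (hp2 : p ≠ 2) {n : ℕ} (x : AdjoinRoot (X ^ 2 ^ a + 1 : (ZMod p)[X]))
    (hx : x ^ n = 0) : x = 0 := by
  refine pow_two_pow_eq_zero_R hp hp2 n x ?_
  have hlt : n ≤ 2 ^ n := (Nat.lt_two_pow_self).le
  rw [← Nat.add_sub_cancel' hlt, pow_add, hx, zero_mul]

end Iterates

/-! ## §2 Units: `σ^i(g) = g · u_i` and `∏_{i<n} u_i v_i = 1` -/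

section Units

/-- **`σ^i(g) = g · Σ_{t<e^i} η^t`** (`g = 1 + μ^{2^a} = 1 − η`, `e` odd). [cite: Washington1997, Prop. 2.8] -/
theorem iterate_one_add_root_pow (he : e % 2 ^ (a + 1) = 1)
    (σ : AdjoinRoot (cyclotomic (2 ^ (a + 1) * p) ℤ) →+* AdjoinRoot (cyclotomic (2 ^ (a + 1) * p) ℤ))
    (hσ : σ (AdjoinRoot.root (cyclotomic (2 ^ (a + 1) * p) ℤ)) = AdjoinRoot.root (cyclotomic (2 ^ (a + 1) * p) ℤ) ^ e)
    (i : ℕ) :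
    σ^[i] (1 + AdjoinRoot.root (cyclotomic (2 ^ (a + 1) * p) ℤ) ^ 2 ^ a) =
      (1 + AdjoinRoot.root (cyclotomic (2 ^ (a + 1) * p) ℤ) ^ 2 ^ a) *
        ∑ t ∈ Finset.range (e ^ i), ((-(AdjoinRoot.root (cyclotomic (2 ^ (a + 1) * p) ℤ)) ^ 2 ^ a)) ^ t := by
  rw [← RingHom.coe_pow]
  exact map_one_add_root_pow (σ ^ i) ((Residue.odd_exp he).pow) (pow_apply_root σ hσ i)

/-- **`∏_{i<n} (u_i v_i) = 1`**: `(Σ_{t<e^i} η^t)(Σ_{t<e^{n−i}} η^{e^i t}) = 1` for `i < n` as `e^i e^{n−i} = e^n ≡ 1 (mod p)`.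
[folklore] -/
theorem prod_geom_mul_geom_eq_one (hp : p.Prime) (hp2 : p ≠ 2) {n : ℕ} (hen : e ^ n % p = 1) :
    ∏ i ∈ Finset.range n, ((∑ t ∈ Finset.range (e ^ i), ((-(AdjoinRoot.root (cyclotomic (2 ^ (a + 1) * p) ℤ)) ^ 2 ^ a)) ^ t) *
      (∑ t ∈ Finset.range (e ^ (n - i)), (((-(AdjoinRoot.root (cyclotomic (2 ^ (a + 1) * p) ℤ)) ^ 2 ^ a)) ^ (e ^ i)) ^ t)) = 1 := by
  refine Finset.prod_eq_one fun i hi => ?_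
  rw [Finset.mem_range] at hi
  refine geom_mul_geom_eq_one (a := a) hp hp2 ?_
  rw [← pow_add, Nat.add_sub_cancel' hi.le, hen]

/-- `e^m ≠ 0` in any field over `𝔽_p` when `e^n ≡ 1 (mod p)`, `n ≥ 1`. [folklore] -/
theorem cast_exp_ne_zero {k : Type*} [Field k] [Algebra (ZMod p) k] (hp : p.Prime) {n : ℕ} (hn : 0 < n)
    (hen : e ^ n % p = 1) (m : ℕ) : ((e ^ m : ℕ) : k) ≠ 0 := by
  haveI : Fact p.Prime := ⟨hp⟩
  have he0 : ((e : ℕ) : ZMod p) ≠ 0 := by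
    intro h0
    have h1 : ((e ^ n : ℕ) : ZMod p) = 1 := by
      rw [← ZMod.natCast_mod, hen, Nat.cast_one]
    rw [Nat.cast_pow, h0, zero_pow hn.ne'] at h1
    exact zero_ne_one h1
  rw [← map_natCast (algebraMap (ZMod p) k), _root_.map_ne_zero, Nat.cast_pow]
  exact pow_ne_zero _ he0

/-- **`π(∏_{i<n} v_i)^{p−1} = 1`**: `π(v_i) = e^{n−i}` is a unit of `𝔽_p`. [folklore] -/
theorem pi_prod_geom_pow_eq_one {k : Type*} [Field k] [Algebra (ZMod p) k] (hp : p.Prime) {n : ℕ} (hn : 0 < n)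
    (hen : e ^ n % p = 1) (π : AdjoinRoot (cyclotomic (2 ^ (a + 1) * p) ℤ) →+* k) {s : k}
    (hπ : π (AdjoinRoot.root (cyclotomic (2 ^ (a + 1) * p) ℤ)) = s) (hs : s ^ 2 ^ a = -1) :
    (π (∏ i ∈ Finset.range n, ∑ t ∈ Finset.range (e ^ (n - i)),
        (((-(AdjoinRoot.root (cyclotomic (2 ^ (a + 1) * p) ℤ)) ^ 2 ^ a)) ^ (e ^ i)) ^ t)) ^ (p - 1) = 1 := by
  haveI : Fact p.Prime := ⟨hp⟩
  rw [map_prod]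
  simp_rw [pi_geom π hπ hs]
  rw [← Nat.cast_prod, ← map_natCast (algebraMap (ZMod p) k), ← map_pow]
  have hne : ((∏ i ∈ Finset.range n, e ^ (n - i) : ℕ) : ZMod p) ≠ 0 := by
    rw [Nat.cast_prod]
    refine Finset.prod_ne_zero_iff.2 fun i _ => ?_
    have := cast_exp_ne_zero (k := ZMod p) hp hn hen (n - i)
    exact this
  rw [ZMod.pow_card_sub_one_eq_one hne, map_one]

end Units

/-! ## §3 One `g`-adic step for the degree-`n` norm -/

section Peel

/-- **Peeling `n` factors of `g`.**  If `∏_{i<n} σ^i(Z) = g^{n(m+1)} V` (`n ≥ 1`) then `Z = g Z₁` with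
`∏_{i<n} σ^i(Z₁) = g^{n m} (W V)`, `W = ∏_{i<n} v_i`, `v_i = Σ_{t<e^{n−i}} η^{e^i t}`. [cite: Washington1997, Prop. 2.8] -/
theorem peel_pow (hp : p.Prime) (hp2 : p ≠ 2) (he : e % 2 ^ (a + 1) = 1) {n : ℕ} (hn : 0 < n) (hen : e ^ n % p = 1)
    (σ : AdjoinRoot (cyclotomic (2 ^ (a + 1) * p) ℤ) →+* AdjoinRoot (cyclotomic (2 ^ (a + 1) * p) ℤ))
    (hσ : σ (AdjoinRoot.root (cyclotomic (2 ^ (a + 1) * p) ℤ)) = AdjoinRoot.root (cyclotomic (2 ^ (a + 1) * p) ℤ) ^ e)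
    (m : ℕ) (Z V : AdjoinRoot (cyclotomic (2 ^ (a + 1) * p) ℤ))
    (hZ : ∏ i ∈ Finset.range n, σ^[i] Z = (1 + AdjoinRoot.root (cyclotomic (2 ^ (a + 1) * p) ℤ) ^ 2 ^ a) ^ (n * (m + 1)) * V) :
    ∃ Z₁ : AdjoinRoot (cyclotomic (2 ^ (a + 1) * p) ℤ),
      ∏ i ∈ Finset.range n, σ^[i] Z₁ = (1 + AdjoinRoot.root (cyclotomic (2 ^ (a + 1) * p) ℤ) ^ 2 ^ a) ^ (n * m) *
        ((∏ i ∈ Finset.range n, ∑ t ∈ Finset.range (e ^ (n - i)),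
          (((-(AdjoinRoot.root (cyclotomic (2 ^ (a + 1) * p) ℤ)) ^ 2 ^ a)) ^ (e ^ i)) ^ t) * V) := by
  haveI := isDomain (a := a) hp.pos
  set μ := AdjoinRoot.root (cyclotomic (2 ^ (a + 1) * p) ℤ) with hμ_def
  set η := -μ ^ 2 ^ a with hη_def
  set πR := AdjoinRoot.lift (Int.castRingHom _) (AdjoinRoot.root (X ^ 2 ^ a + 1 : (ZMod p)[X]))
    (eval₂_cyclotomic_R (a := a) hp hp2) with hπR_def
  -- `π_R(Z)^n = 0`, hence `π_R(Z) = 0`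
  have hvan : πR Z = 0 := by
    have h := congrArg πR hZ
    rw [map_prod, map_mul, map_pow, hπR_def, liftR_one_add_root_pow hp hp2,
      zero_pow (Nat.mul_pos hn m.succ_pos).ne', zero_mul] at h
    have h2 : (AdjoinRoot.lift (Int.castRingHom _) (AdjoinRoot.root (X ^ 2 ^ a + 1 : (ZMod p)[X]))
        (eval₂_cyclotomic_R (a := a) hp hp2) Z) ^ n = 0 := by
      rw [← h, Finset.prod_congr rfl fun i _ => liftR_iterate_eq hp hp2 he σ hσ i Z, Finset.prod_const,
        Finset.card_range]
    exact pow_eq_zero_R hp hp2 _ h2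
  obtain ⟨Z₁, rfl⟩ := exists_eq_mul_of_liftR_eq_zero hp hp2 Z hvan
  refine ⟨Z₁, ?_⟩
  have hg := one_add_root_pow_ne_zero (a := a) hp hp2
  -- split the norm of `g Z₁`
  have hsplit : ∏ i ∈ Finset.range n, σ^[i] ((1 + μ ^ 2 ^ a) * Z₁) =
      (1 + μ ^ 2 ^ a) ^ n * ((∏ i ∈ Finset.range n, ∑ t ∈ Finset.range (e ^ i), η ^ t) *
        ∏ i ∈ Finset.range n, σ^[i] Z₁) := by
    have h1 : ∀ i ∈ Finset.range n, σ^[i] ((1 + μ ^ 2 ^ a) * Z₁) =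
        (1 + μ ^ 2 ^ a) * ((∑ t ∈ Finset.range (e ^ i), η ^ t) * σ^[i] Z₁) := fun i _ => by
      rw [iterate_mul, iterate_one_add_root_pow he σ hσ i, mul_assoc]
    rw [Finset.prod_congr rfl h1, Finset.prod_mul_distrib, Finset.prod_const, Finset.card_range, Finset.prod_mul_distrib]
  rw [hsplit] at hZ
  -- cancel `g^n`
  have e4 : (1 + μ ^ 2 ^ a) ^ (n * (m + 1)) = (1 + μ ^ 2 ^ a) ^ n * (1 + μ ^ 2 ^ a) ^ (n * m) := by
    rw [← pow_add]; congr 1; ring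
  rw [e4, mul_assoc] at hZ
  have h3 := mul_left_cancel₀ (pow_ne_zero n hg) hZ
  have hW : (∏ i ∈ Finset.range n, ∑ t ∈ Finset.range (e ^ (n - i)), (η ^ (e ^ i)) ^ t) *
      (∏ i ∈ Finset.range n, ∑ t ∈ Finset.range (e ^ i), η ^ t) = 1 := by
    have h5 := prod_geom_mul_geom_eq_one (a := a) hp hp2 hen (e := e)
    rw [Finset.prod_mul_distrib] at h5
    linear_combination h5
  have h4 := congrArg (fun x => (∏ i ∈ Finset.range n, ∑ t ∈ Finset.range (e ^ (n - i)), (η ^ (e ^ i)) ^ t) * x) h3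
  rw [← mul_assoc, hW, one_mul] at h4
  rw [h4]
  ring

/-- **Iterated peeling** (degree `n`). [cite: Washington1997, Prop. 2.8] -/
theorem peel_pow_iter (hp : p.Prime) (hp2 : p ≠ 2) (he : e % 2 ^ (a + 1) = 1) {n : ℕ} (hn : 0 < n)
    (hen : e ^ n % p = 1)
    (σ : AdjoinRoot (cyclotomic (2 ^ (a + 1) * p) ℤ) →+* AdjoinRoot (cyclotomic (2 ^ (a + 1) * p) ℤ))
    (hσ : σ (AdjoinRoot.root (cyclotomic (2 ^ (a + 1) * p) ℤ)) = AdjoinRoot.root (cyclotomic (2 ^ (a + 1) * p) ℤ) ^ e) :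
    ∀ (m : ℕ) (Z V : AdjoinRoot (cyclotomic (2 ^ (a + 1) * p) ℤ)),
      ∏ i ∈ Finset.range n, σ^[i] Z = (1 + AdjoinRoot.root (cyclotomic (2 ^ (a + 1) * p) ℤ) ^ 2 ^ a) ^ (n * m) * V →
      ∃ Z' : AdjoinRoot (cyclotomic (2 ^ (a + 1) * p) ℤ),
        ∏ i ∈ Finset.range n, σ^[i] Z' =
          (∏ i ∈ Finset.range n, ∑ t ∈ Finset.range (e ^ (n - i)),
            (((-(AdjoinRoot.root (cyclotomic (2 ^ (a + 1) * p) ℤ)) ^ 2 ^ a)) ^ (e ^ i)) ^ t) ^ m * V := by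
  intro m
  induction m with
  | zero =>
    intro Z V h
    exact ⟨Z, by rw [h, mul_zero, pow_zero, one_mul, pow_zero, one_mul]⟩
  | succ m ih =>
    intro Z V h
    obtain ⟨Z₁, h₁⟩ := peel_pow hp hp2 he hn hen σ hσ m Z V h
    obtain ⟨Z', h'⟩ := ih Z₁ _ h₁
    exact ⟨Z', by rw [h', ← mul_assoc, ← pow_succ]⟩

end Peel

/-! ## §4 The descent -/

/-- **THE DEGREE-`2^j` DESCENT THROUGH A RESIDUE FIELD** (`1 ≤ j ≤ a + 1`; `e ≡ 1 (mod 2^{a+1})`, `e^{2^j} ≡ 1 (mod p)`;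
`σ(μ) = μ^e`; `k ⊇ 𝔽_p` a field, `π(μ) = s`, `s^{2^a} = −1`, and NO `x ∈ k` with `x^{2^{a+1}} = −1`; `t₀` odd): no `N ≥ 1`,
`Z, U ∈ Λ`, `c ∈ kˣ` with `π(U) = c^{2^j}` satisfy `∏_{i<2^j} σ^i(Z) = N^{2^j} μ^{p 2^{j−1} t₀} U` — `ω^{2^{j−1}}` is not a norm of
degree `2^j` for any primitive `2^{a+1}`-th root of unity `ω`. [cite: FeinGordonSmith1971, pp. 310–315]
[cite: Pierce1982, §15.1] -/
theorem descent_pow (hp : p.Prime) (hp2 : p ≠ 2) {j : ℕ} (hj1 : 1 ≤ j) (hja : j ≤ a + 1) (he : e % 2 ^ (a + 1) = 1)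
    (hen : e ^ 2 ^ j % p = 1)
    (σ : AdjoinRoot (cyclotomic (2 ^ (a + 1) * p) ℤ) →+* AdjoinRoot (cyclotomic (2 ^ (a + 1) * p) ℤ))
    (hσ : σ (AdjoinRoot.root (cyclotomic (2 ^ (a + 1) * p) ℤ)) = AdjoinRoot.root (cyclotomic (2 ^ (a + 1) * p) ℤ) ^ e)
    {k : Type*} [Field k] [Algebra (ZMod p) k] (π : AdjoinRoot (cyclotomic (2 ^ (a + 1) * p) ℤ) →+* k) {s : k}
    (hπ : π (AdjoinRoot.root (cyclotomic (2 ^ (a + 1) * p) ℤ)) = s) (hs : s ^ 2 ^ a = -1)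
    (hk : ∀ x : k, x ^ 2 ^ (a + 1) ≠ -1) {t₀ : ℕ} (ht₀ : Odd t₀) :
    ∀ (N : ℕ), 0 < N → ∀ (Z U : AdjoinRoot (cyclotomic (2 ^ (a + 1) * p) ℤ)) (c : k), c ≠ 0 → π U = c ^ 2 ^ j →
      ∏ i ∈ Finset.range (2 ^ j), σ^[i] Z =
        (N : AdjoinRoot (cyclotomic (2 ^ (a + 1) * p) ℤ)) ^ 2 ^ j *
          (AdjoinRoot.root (cyclotomic (2 ^ (a + 1) * p) ℤ) ^ (p * (2 ^ (j - 1) * t₀)) * U) →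
      False := by
  haveI := isDomain (a := a) hp.pos
  haveI : Fact p.Prime := ⟨hp⟩
  have hn : 0 < 2 ^ j := by positivity
  obtain ⟨j', rfl⟩ : ∃ j', j = j' + 1 := ⟨j - 1, by omega⟩
  have hj' : j' ≤ a := by omega
  set μ := AdjoinRoot.root (cyclotomic (2 ^ (a + 1) * p) ℤ) with hμ_def
  set W := ∏ i ∈ Finset.range (2 ^ (j' + 1)), ∑ t ∈ Finset.range (e ^ (2 ^ (j' + 1) - i)),
    ((-μ ^ 2 ^ a) ^ (e ^ i)) ^ t with hW_def
  have hπσ : ∀ i Z, π (σ^[i] Z) = π Z := pi_iterate_eq he σ hσ π hπ hs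
  set ε := ∏ j ∈ Finset.range (p - 1), ∑ m ∈ Finset.range (j + 1), (-μ ^ 2 ^ a) ^ m with hε_def
  have hpε : ((p : ℕ) : AdjoinRoot (cyclotomic (2 ^ (a + 1) * p) ℤ)) = (1 + μ ^ 2 ^ a) ^ (p - 1) * ε :=
    prime_eq_pow_mul hp hp2
  have hπε : π ε ≠ 0 := pi_eps_ne_zero hp π hπ hs
  have hπWp : π W ^ (p - 1) = 1 := pi_prod_geom_pow_eq_one hp hn hen π hπ hs
  -- `π(μ^{p 2^{j−1} t₀})` raised to `2^{a+1−j}` is `−1`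
  have h2a : 2 ^ j' * 2 ^ (a - j') = 2 ^ a := by rw [← pow_add, Nat.add_sub_cancel' hj']
  have hω : (π (μ ^ (p * (2 ^ (j' + 1 - 1) * t₀)))) ^ 2 ^ (a - j') = -1 := by
    rw [Nat.add_sub_cancel, map_pow, hπ, ← pow_mul,
      show p * (2 ^ j' * t₀) * 2 ^ (a - j') = (2 ^ j' * 2 ^ (a - j')) * (p * t₀) by ring, h2a, pow_mul, hs]
    exact ((hp.odd_of_ne_two hp2).mul ht₀).neg_one_pow
  have h2j : 2 ^ (a + 1) = 2 ^ (j' + 1) * 2 ^ (a - j') := by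
    rw [← pow_add]; congr 1; omega
  intro N
  induction N using Nat.strong_induction_on with
  | _ N ih =>
  intro hN Z U c hc hU hrel
  by_cases hpN : p ∣ N
  · obtain ⟨N', rfl⟩ := hpN
    have hN' : 0 < N' := Nat.pos_of_mul_pos_left hN
    have hrel' : ∏ i ∈ Finset.range (2 ^ (j' + 1)), σ^[i] Z = (1 + μ ^ 2 ^ a) ^ (2 ^ (j' + 1) * (p - 1)) *
        (ε ^ 2 ^ (j' + 1) * ((N' : AdjoinRoot (cyclotomic (2 ^ (a + 1) * p) ℤ)) ^ 2 ^ (j' + 1) *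
          (μ ^ (p * (2 ^ (j' + 1 - 1) * t₀)) * U))) := by
      rw [hrel, Nat.cast_mul, hpε]; ring
    obtain ⟨Z', hZ'⟩ := peel_pow_iter hp hp2 he hn hen σ hσ (p - 1) Z _ hrel'
    refine ih N' (by have := hp.two_le; nlinarith) hN' Z' (W ^ (p - 1) * ε ^ 2 ^ (j' + 1) * U) (π ε * c)
      (mul_ne_zero hπε hc) ?_ ?_
    · rw [map_mul, map_mul, map_pow, map_pow, hπWp, hU]; ring
    · rw [hZ']; ring
  · have hNz : ((N : ℕ) : k) ≠ 0 := by
      rw [← map_natCast (algebraMap (ZMod p) k), _root_.map_ne_zero, Ne, ZMod.natCast_eq_zero_iff]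
      exact hpN
    have h := congrArg π hrel
    rw [map_prod, map_mul, map_mul, map_pow, map_natCast, hU] at h
    simp_rw [hπσ] at h
    rw [Finset.prod_const, Finset.card_range] at h
    set x : k := π Z / ((N : k) * c) with hx_def
    have hxn : x ^ 2 ^ (j' + 1) = π (μ ^ (p * (2 ^ (j' + 1 - 1) * t₀))) := by
      rw [hx_def, div_pow, div_eq_iff (pow_ne_zero _ (mul_ne_zero hNz hc))]
      linear_combination h
    have hx : x ^ 2 ^ (a + 1) = -1 := by
      rw [h2j, pow_mul, hxn, hω]
    exact hk x hx

end Summit.HodgeConjecture.CorCM.CyclotomicTwoPowerP.Cyclic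

end
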